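import Summits.RiemannHypothesis.RiemannHypothesis.Theorems.WeilTwoPrimeDeflC83XDef
import Summits.RiemannHypothesis.RiemannHypothesis.Theorems.WeilTwoPrimeDeflC83XDataPE30
import Literature.NumberTheory.LFunctions.WeilBlockRowsR
import HarnessLib

/-!
# Deflated two-prime certificate C83X: the materialized even block agrees with `P_r + Σ μ ĉ ĉᵀ`, rows 32–47

`WeilCert.checkPmRowG` for certificate C83X (even block), by `decide +kernel`. Pure proof file; nothing is asserted.
-/

set_option linter.dupNamespace false

noncomputable section

namespace Summit.RiemannHypothesis.RiemannHypothesis.Theorems.EvenWinsBeyondArch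

open Literature.NumberTheory.LFunctions

set_option maxHeartbeats 0 in
/-- Row 32 of the materialized even block is row 32 of `P_r + Σ μ ĉ ĉᵀ` (certificate C83X). [folklore] -/
theorem checkPmRowG0_32_weilCertDeflC83X : weilCertDeflC83XBase.checkPmRowG weilCertDeflC83XP weilCertDeflC83XPmE 0 32 = true := by
  decide +kernel

set_option maxHeartbeats 0 in
/-- Row 33 of the materialized even block is row 33 of `P_r + Σ μ ĉ ĉᵀ` (certificate C83X). [folklore] -/
theorem checkPmRowG0_33_weilCertDeflC83X : weilCertDeflC83XBase.checkPmRowG weilCertDeflC83XP weilCertDeflC83XPmE 0 33 = true := by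
  decide +kernel

set_option maxHeartbeats 0 in
/-- Row 34 of the materialized even block is row 34 of `P_r + Σ μ ĉ ĉᵀ` (certificate C83X). [folklore] -/
theorem checkPmRowG0_34_weilCertDeflC83X : weilCertDeflC83XBase.checkPmRowG weilCertDeflC83XP weilCertDeflC83XPmE 0 34 = true := by
  decide +kernel

set_option maxHeartbeats 0 in
/-- Row 35 of the materialized even block is row 35 of `P_r + Σ μ ĉ ĉᵀ` (certificate C83X). [folklore] -/
theorem checkPmRowG0_35_weilCertDeflC83X : weilCertDeflC83XBase.checkPmRowG weilCertDeflC83XP weilCertDeflC83XPmE 0 35 = true := by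
  decide +kernel

set_option maxHeartbeats 0 in
/-- Row 36 of the materialized even block is row 36 of `P_r + Σ μ ĉ ĉᵀ` (certificate C83X). [folklore] -/
theorem checkPmRowG0_36_weilCertDeflC83X : weilCertDeflC83XBase.checkPmRowG weilCertDeflC83XP weilCertDeflC83XPmE 0 36 = true := by
  decide +kernel

set_option maxHeartbeats 0 in
/-- Row 37 of the materialized even block is row 37 of `P_r + Σ μ ĉ ĉᵀ` (certificate C83X). [folklore] -/
theorem checkPmRowG0_37_weilCertDeflC83X : weilCertDeflC83XBase.checkPmRowG weilCertDeflC83XP weilCertDeflC83XPmE 0 37 = true := by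
  decide +kernel

set_option maxHeartbeats 0 in
/-- Row 38 of the materialized even block is row 38 of `P_r + Σ μ ĉ ĉᵀ` (certificate C83X). [folklore] -/
theorem checkPmRowG0_38_weilCertDeflC83X : weilCertDeflC83XBase.checkPmRowG weilCertDeflC83XP weilCertDeflC83XPmE 0 38 = true := by
  decide +kernel

set_option maxHeartbeats 0 in
/-- Row 39 of the materialized even block is row 39 of `P_r + Σ μ ĉ ĉᵀ` (certificate C83X). [folklore] -/
theorem checkPmRowG0_39_weilCertDeflC83X : weilCertDeflC83XBase.checkPmRowG weilCertDeflC83XP weilCertDeflC83XPmE 0 39 = true := by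
  decide +kernel

set_option maxHeartbeats 0 in
/-- Row 40 of the materialized even block is row 40 of `P_r + Σ μ ĉ ĉᵀ` (certificate C83X). [folklore] -/
theorem checkPmRowG0_40_weilCertDeflC83X : weilCertDeflC83XBase.checkPmRowG weilCertDeflC83XP weilCertDeflC83XPmE 0 40 = true := by
  decide +kernel

set_option maxHeartbeats 0 in
/-- Row 41 of the materialized even block is row 41 of `P_r + Σ μ ĉ ĉᵀ` (certificate C83X). [folklore] -/
theorem checkPmRowG0_41_weilCertDeflC83X : weilCertDeflC83XBase.checkPmRowG weilCertDeflC83XP weilCertDeflC83XPmE 0 41 = true := by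
  decide +kernel

set_option maxHeartbeats 0 in
/-- Row 42 of the materialized even block is row 42 of `P_r + Σ μ ĉ ĉᵀ` (certificate C83X). [folklore] -/
theorem checkPmRowG0_42_weilCertDeflC83X : weilCertDeflC83XBase.checkPmRowG weilCertDeflC83XP weilCertDeflC83XPmE 0 42 = true := by
  decide +kernel

set_option maxHeartbeats 0 in
/-- Row 43 of the materialized even block is row 43 of `P_r + Σ μ ĉ ĉᵀ` (certificate C83X). [folklore] -/
theorem checkPmRowG0_43_weilCertDeflC83X : weilCertDeflC83XBase.checkPmRowG weilCertDeflC83XP weilCertDeflC83XPmE 0 43 = true := by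
  decide +kernel

set_option maxHeartbeats 0 in
/-- Row 44 of the materialized even block is row 44 of `P_r + Σ μ ĉ ĉᵀ` (certificate C83X). [folklore] -/
theorem checkPmRowG0_44_weilCertDeflC83X : weilCertDeflC83XBase.checkPmRowG weilCertDeflC83XP weilCertDeflC83XPmE 0 44 = true := by
  decide +kernel

set_option maxHeartbeats 0 in
/-- Row 45 of the materialized even block is row 45 of `P_r + Σ μ ĉ ĉᵀ` (certificate C83X). [folklore] -/
theorem checkPmRowG0_45_weilCertDeflC83X : weilCertDeflC83XBase.checkPmRowG weilCertDeflC83XP weilCertDeflC83XPmE 0 45 = true := by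
  decide +kernel

set_option maxHeartbeats 0 in
/-- Row 46 of the materialized even block is row 46 of `P_r + Σ μ ĉ ĉᵀ` (certificate C83X). [folklore] -/
theorem checkPmRowG0_46_weilCertDeflC83X : weilCertDeflC83XBase.checkPmRowG weilCertDeflC83XP weilCertDeflC83XPmE 0 46 = true := by
  decide +kernel

set_option maxHeartbeats 0 in
/-- Row 47 of the materialized even block is row 47 of `P_r + Σ μ ĉ ĉᵀ` (certificate C83X). [folklore] -/
theorem checkPmRowG0_47_weilCertDeflC83X : weilCertDeflC83XBase.checkPmRowG weilCertDeflC83XP weilCertDeflC83XPmE 0 47 = true := by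
  decide +kernel


end Summit.RiemannHypothesis.RiemannHypothesis.Theorems.EvenWinsBeyondArch
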